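import Mathlib
import Summits.Ventures.PercRepro2.Defs
import Summits.Ventures.PercRepro2.Independence
import Summits.Ventures.PercRepro2.Harris
import Summits.Ventures.PercRepro2.Graph
import Summits.Ventures.PercRepro2.Events
import Summits.Ventures.PercRepro2.Induced
import Summits.Ventures.PercRepro2.ObsIndependence
import Summits.Ventures.PercRepro2.BHK
import Summits.Ventures.PercRepro2.BHKEvents

/-!
# BHK06 Theorem 1.5 in its general (functional) form: the pair `(C_s, V ∖ C_t)` is positively
associated given `s ↮ t` (blind cell PercRepro2, mine-2 g19; proofs/MINE2-JOINTPA.md §2)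

Van den Berg–Häggström–Kahn, *Some conditional correlation inequalities for percolation and related
processes*, Random Structures & Algorithms 29 (2006), doi:10.1002/rsa.20102, Theorem 1.5: for
`f, g` bounded functions of `(C_s, C_t)`, each increasing in `C_s` and decreasing in `C_t`,
`E[f g | s ↮ t] ≥ E[f | s ↮ t] · E[g | s ↮ t]`.  The tree holds the boundary cases
(`bhk_same_cluster`, `bhk_cross_cluster`) and several indicator instances (`BHKMixed.lean`,
`BHKMixedAnti.lean`); this file proves the statement for arbitrary nonnegative functionals
`F G : Set V → Set V → R` (the bounded case follows by shifting), multiplied out: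

  `E[F(C_s, C_t) 1_Q] · E[G(C_s, C_t) 1_Q] ≤ E[(F G)(C_s, C_t) 1_Q] · P(Q)`,  `Q = {s ↮ t}`.

The proof is BHK06's (the whole-cluster step of the cell's lens): explore `C_s = W`; on `Q` the
cluster of `t` is its cluster in `G ∖ W` (`cluster_delConfig_cluster`), so the tower identity
`expect_tower` rewrites `E[F(C_s, C_t) 1_Q] = E[F̂(C_s) 1_Q]` with
`F̂(W) = E[F(W, C_t) in G ∖ W]` (written out: `expect p (fun ω => F W (cluster (delConfig W ω) t))`); in `G ∖ W` the two functions `F(W, ·)`, `G(W, ·)`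
are decreasing functions of the configuration, so Harris gives `F̂ Ĝ ≤ (F G)^` pointwise; and
`F̂`, `Ĝ` are monotone nonnegative cluster functionals of `C_s` (`delConfig_anti`), so
`bhk_same_cluster` (BHK 1.3) closes the argument.
-/

namespace Summit.Ventures.PercRepro2

namespace BHKPair



section Main

variable {V : Type*} {E : Type*} [Fintype E] [DecidableEq E] [Fintype V] [DecidableEq V]
  {R : Type*} [CommRing R] [LinearOrder R] [IsStrictOrderedRing R]

omit [Fintype E] [DecidableEq E] [Fintype V] [DecidableEq V] [LinearOrder R]
  [IsStrictOrderedRing R] in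
/-- `delConfig` is monotone in the configuration. -/
lemma delConfig_mono_config (ends : E → Sym2 V) (W : Set V) {ω ω' : Config E} (h : ω ≤ ω') :
    delConfig ends W ω ≤ delConfig ends W ω' := by
  intro e
  by_cases he : e ∈ touches ends W
  · rw [delConfig_apply_of_mem he, delConfig_apply_of_mem he]
  · rw [delConfig_apply_of_notMem he, delConfig_apply_of_notMem he]
    exact h e

omit [Fintype V] [DecidableEq V] in
/-- `F̂` is monotone in `W`: a larger explored cluster leaves a smaller cluster of `t`. -/
lemma delPairExpect_mono (p : E → R) (hp : IsProbVec p) (ends : E → Sym2 V) (t : V)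
    {F : Set V → Set V → R} (hF : ∀ ⦃W W' C C' : Set V⦄, W ⊆ W' → C' ⊆ C → F W C ≤ F W' C') :
    Monotone (fun W => expect p (fun ω => F W (cluster ends (delConfig ends W ω) t))) := by
  intro W W' h
  exact expect_mono hp fun ω => hF h (cluster_mono (ends := ends) (delConfig_anti h ω) t)

omit [Fintype V] [DecidableEq V] in
/-- `F̂ ≥ 0` for `F ≥ 0`. -/
lemma delPairExpect_nonneg (p : E → R) (hp : IsProbVec p) (ends : E → Sym2 V) (t : V)
    {F : Set V → Set V → R} (hF0 : ∀ W C, 0 ≤ F W C) (W : Set V) :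
    0 ≤ expect p (fun ω => F W (cluster ends (delConfig ends W ω) t)) :=
  expect_nonneg hp fun _ => hF0 _ _

omit [Fintype V] [DecidableEq V] in
/-- **Harris in `G ∖ W`**: `F̂(W) · Ĝ(W) ≤ (F G)^(W)` — `F(W, C_t)` and `G(W, C_t)` are decreasing
functions of the configuration of `G ∖ W`. -/
lemma delPairExpect_mul_le (p : E → R) (hp : IsProbVec p) (ends : E → Sym2 V) (t : V)
    {F G : Set V → Set V → R} (hF : ∀ ⦃W W' C C' : Set V⦄, W ⊆ W' → C' ⊆ C → F W C ≤ F W' C') (hG : ∀ ⦃W W' C C' : Set V⦄, W ⊆ W' → C' ⊆ C → G W C ≤ G W' C') (W : Set V) :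
    expect p (fun ω => F W (cluster ends (delConfig ends W ω) t)) *
        expect p (fun ω => G W (cluster ends (delConfig ends W ω) t)) ≤
      expect p (fun ω => F W (cluster ends (delConfig ends W ω) t) *
        G W (cluster ends (delConfig ends W ω) t)) := by
  have hf : Monotone (fun ω => (-1 : R) * F W (cluster ends (delConfig ends W ω) t)) := by
    intro ω ω' h
    have := hF (subset_refl W) (cluster_mono (ends := ends) (delConfig_mono_config ends W h) t)
    simp only
    linarith
  have hg : Monotone (fun ω => (-1 : R) * G W (cluster ends (delConfig ends W ω) t)) := by
    intro ω ω' h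
    have := hG (subset_refl W) (cluster_mono (ends := ends) (delConfig_mono_config ends W h) t)
    simp only
    linarith
  have key := expect_mul_expect_le_expect_mul hp hf hg
  rw [expect_const_mul, expect_const_mul] at key
  have e : ((fun ω => (-1 : R) * F W (cluster ends (delConfig ends W ω) t)) *
      fun ω => (-1 : R) * G W (cluster ends (delConfig ends W ω) t)) =
      fun ω => F W (cluster ends (delConfig ends W ω) t) * G W (cluster ends (delConfig ends W ω) t) := by
    funext ω
    simp only [Pi.mul_apply]
    ring
  rw [e] at key
  linarith [key]

omit [DecidableEq V] [LinearOrder R] [IsStrictOrderedRing R] in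
/-- **The tower identity**: `E[F(C_s, C_t) 1_Q] = E[F̂(C_s) 1_Q]` — exploring the cluster of `s`,
on `Q` the cluster of `t` is its cluster in `G ∖ C_s`. -/
theorem expect_pair_mul_indicator (p : E → R) (ends : E → Sym2 V) (s t : V)
    (F : Set V → Set V → R) :
    expect p (fun ω => F (cluster ends ω s) (cluster ends ω t) *
        ((connEvent ends s t)ᶜ).indicator 1 ω) =
      expect p (fun ω => expect p (fun ω' => F (cluster ends ω s)
        (cluster ends (delConfig ends (cluster ends ω s) ω') t)) *
        ((connEvent ends s t)ᶜ).indicator 1 ω) := by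
  classical
  let c : Set V → R := fun W => ({W' : Set V | t ∉ W'}.indicator 1 W)
  let D : Set V → Config E → R := fun W ω => F W (cluster ends (delConfig ends W ω) t)
  let Φ : Set V → Config E → R := fun W ω => c W * D W ω
  have hΦ : ∀ W, DependsOn (Φ W) (touches ends W)ᶜ := by
    intro W ω ω' h
    simp only [Φ, D]
    rw [delConfig_congr h]
  have hS : ∀ W : Set V, DependsOn (· ∈ {ω | cluster ends ω s = W}) (touches ends W) :=
    fun W => dependsOn_clusterEvent ends s W
  have hdisj : ∀ W : Set V, Disjoint (touches ends W) (touches ends W)ᶜ :=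
    fun W => disjoint_compl_right
  -- pointwise: `F(C_s, C_t) 1_Q = Φ (C_s) ·`
  have hpt : ∀ ω, F (cluster ends ω s) (cluster ends ω t) *
      ((connEvent ends s t)ᶜ).indicator (1 : Config E → R) ω = Φ (cluster ends ω s) ω := by
    intro ω
    simp only [Φ, c, D]
    by_cases hst : t ∈ cluster ends ω s
    · rw [Set.indicator_of_notMem (show ω ∉ (connEvent ends s t)ᶜ from fun h => h hst),
        Set.indicator_of_notMem (show cluster ends ω s ∉ {W' : Set V | t ∉ W'} from fun h => h hst)]
      simp
    · rw [Set.indicator_of_mem (show ω ∈ (connEvent ends s t)ᶜ from hst),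
        Set.indicator_of_mem (show cluster ends ω s ∈ {W' : Set V | t ∉ W'} from hst),
        cluster_delConfig_cluster hst]
      simp
  -- `E[Φ W] = c W · F̂(W)`
  have hΦexp : ∀ W, expect p (Φ W) =
      c W * expect p (fun ω' => F W (cluster ends (delConfig ends W ω') t)) := by
    intro W
    simp only [Φ, D]
    rw [expect_const_mul]
  have e1 : (fun ω => F (cluster ends ω s) (cluster ends ω t) *
      ((connEvent ends s t)ᶜ).indicator (1 : Config E → R) ω) = fun ω => Φ (cluster ends ω s) ω :=
    funext hpt
  rw [e1, expect_tower p hdisj (S := fun ω => cluster ends ω s) hS hΦ]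
  simp only [hΦexp]
  unfold expect
  refine Finset.sum_congr rfl fun ω _ => ?_
  simp only [c]
  by_cases hst : t ∈ cluster ends ω s
  · rw [Set.indicator_of_notMem (show cluster ends ω s ∉ {W' : Set V | t ∉ W'} from fun h => h hst),
      Set.indicator_of_notMem (show ω ∉ (connEvent ends s t)ᶜ from fun h => h hst)]
    simp
  · rw [Set.indicator_of_mem (show cluster ends ω s ∈ {W' : Set V | t ∉ W'} from hst),
      Set.indicator_of_mem (show ω ∈ (connEvent ends s t)ᶜ from hst)]
    simp

/-- **BHK06 Theorem 1.5** (functional form, multiplied out): for nonnegative functionals `F, G`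
of `(C_s, C_t)`, each increasing in `C_s` and decreasing in `C_t`,
`E[F(C_s,C_t) 1_Q] · E[G(C_s,C_t) 1_Q] ≤ E[(F G)(C_s,C_t) 1_Q] · P(Q)`, `Q = {s ↮ t}`: conditionally
on `s ↮ t`, the pair `(C_s, V ∖ C_t)` is positively associated. -/
theorem bhk_pair (p : E → R) (hp : IsProbVec p) (ends : E → Sym2 V) (s t : V)
    {F G : Set V → Set V → R} (hF : ∀ ⦃W W' C C' : Set V⦄, W ⊆ W' → C' ⊆ C → F W C ≤ F W' C') (hG : ∀ ⦃W W' C C' : Set V⦄, W ⊆ W' → C' ⊆ C → G W C ≤ G W' C')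
    (hF0 : ∀ W C, 0 ≤ F W C) (hG0 : ∀ W C, 0 ≤ G W C) :
    expect p (fun ω => F (cluster ends ω s) (cluster ends ω t) *
        ((connEvent ends s t)ᶜ).indicator 1 ω) *
      expect p (fun ω => G (cluster ends ω s) (cluster ends ω t) *
        ((connEvent ends s t)ᶜ).indicator 1 ω) ≤
    expect p (fun ω => F (cluster ends ω s) (cluster ends ω t) *
        G (cluster ends ω s) (cluster ends ω t) * ((connEvent ends s t)ᶜ).indicator 1 ω) *
      prob p (connEvent ends s t)ᶜ := by
  classical
  set Fh : Set V → R := fun W => expect p (fun ω => F W (cluster ends (delConfig ends W ω) t)) with hFh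
  set Gh : Set V → R := fun W => expect p (fun ω => G W (cluster ends (delConfig ends W ω) t)) with hGh
  have hFm : Monotone Fh := delPairExpect_mono p hp ends t hF
  have hGm : Monotone Gh := delPairExpect_mono p hp ends t hG
  have hF0' : ∀ W, 0 ≤ Fh W := delPairExpect_nonneg p hp ends t hF0
  have hG0' : ∀ W, 0 ≤ Gh W := delPairExpect_nonneg p hp ends t hG0
  have key := bhk_same_cluster p hp ends s t hFm hGm hF0' hG0'
  rw [expect_pair_mul_indicator p ends s t F, expect_pair_mul_indicator p ends s t G]
  have eFG : expect p (fun ω => F (cluster ends ω s) (cluster ends ω t) *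
      G (cluster ends ω s) (cluster ends ω t) * ((connEvent ends s t)ᶜ).indicator 1 ω) =
      expect p (fun ω => expect p (fun ω' => F (cluster ends ω s)
        (cluster ends (delConfig ends (cluster ends ω s) ω') t) * G (cluster ends ω s)
        (cluster ends (delConfig ends (cluster ends ω s) ω') t)) *
        ((connEvent ends s t)ᶜ).indicator 1 ω) :=
    expect_pair_mul_indicator p ends s t (fun W C => F W C * G W C)
  rw [eFG]
  -- Harris in `G ∖ W` pointwise, then monotonicity of the expectation
  have hpt : ∀ ω, Fh (cluster ends ω s) * Gh (cluster ends ω s) *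
      ((connEvent ends s t)ᶜ).indicator (1 : Config E → R) ω ≤
      expect p (fun ω' => F (cluster ends ω s) (cluster ends (delConfig ends (cluster ends ω s) ω') t) *
        G (cluster ends ω s) (cluster ends (delConfig ends (cluster ends ω s) ω') t)) *
        ((connEvent ends s t)ᶜ).indicator 1 ω := by
    intro ω
    exact mul_le_mul_of_nonneg_right (delPairExpect_mul_le p hp ends t hF hG _)
      (Set.indicator_apply_nonneg fun _ => zero_le_one)
  have hmono := expect_mono hp hpt
  have hQ0 : 0 ≤ prob p (connEvent ends s t)ᶜ := prob_nonneg hp _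
  calc expect p (fun ω => Fh (cluster ends ω s) * ((connEvent ends s t)ᶜ).indicator 1 ω) *
        expect p (fun ω => Gh (cluster ends ω s) * ((connEvent ends s t)ᶜ).indicator 1 ω)
      ≤ expect p (fun ω => Fh (cluster ends ω s) * Gh (cluster ends ω s) *
          ((connEvent ends s t)ᶜ).indicator 1 ω) * prob p (connEvent ends s t)ᶜ := key
    _ ≤ expect p (fun ω => expect p (fun ω' => F (cluster ends ω s)
          (cluster ends (delConfig ends (cluster ends ω s) ω') t) * G (cluster ends ω s)
          (cluster ends (delConfig ends (cluster ends ω s) ω') t)) *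
          ((connEvent ends s t)ᶜ).indicator 1 ω) * prob p (connEvent ends s t)ᶜ :=
        mul_le_mul_of_nonneg_right hmono hQ0

end Main

end BHKPair

end Summit.Ventures.PercRepro2
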